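import Summits.CriticalPhenomena.PercolationContinuityZ3.Theorems.PercNearOneGluingNoHeavyLowerTailDualBHKGraph
import HarnessLib

/-!
# Dual BHK inequality — support separation `sepEv` and its behaviour under peeling a vertex

Support file 2/7 for the dual BHK inequality `u_b·u_c ≥ t·n′_a` (memo `prim-ineq-gen-2/DUAL-BHK.md` §8;
`--supports stmt-CriticalPhenomena-4575`).  `O ∈ sepEv U E a P Q` says: every `P–Q` path of the support `E` inside `U`
(trivial paths included) has a vertex in the plain open cluster of `a` (open edges `O`).  Lemmas: antitone in `P, Q`,
symmetric, the trivial-path consequence (`P ∩ Q ⊆ C`), invariance under adding edges at a vertex outside `U`, and the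
**peeling rule** (memo Lemma P, sep clause): if `v ∈ Q ∖ P` is not in the cluster (equivalently the cluster computed in
`U ∖ v` misses the open neighbours `K` of `v`), then `Sep_U(P,Q) ↔ Sep_{U∖v}(P, (Q ∖ v) ∪ D_v)` with `D_v = Kset U E v` the
support neighbours of `v`.  [this work]
-/

namespace Summit.CriticalPhenomena.PercolationContinuityZ3.Theorems

namespace DualBHK

open SimpleGraph

variable {V : Type*}

/-! ### Elementary properties -/

section Basic

variable {U : Finset V} {E O : Finset (Sym2 V)} {a : V}

/-- `sepEv` is antitone in the two separated sets. [this work] -/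
theorem sepEv_anti {P P' Q Q' : Set V} (hP : P ⊆ P') (hQ : Q ⊆ Q') : sepEv U E a P' Q' ⊆ sepEv U E a P Q :=
  fun _ h p hp q hq => h p (hP hp) q (hQ hq)

/-- `sepEv` is symmetric in the two separated sets. [this work] -/
theorem sepEv_comm (P Q : Set V) : sepEv U E a P Q = sepEv U E a Q P := by
  ext O
  simp only [mem_sepEv]
  constructor
  · intro h q hq p hp ⟨hq', hp', hr⟩
    exact h p hp q hq ⟨hp', hq', hr.symm⟩
  · intro h p hp q hq ⟨hp', hq', hr⟩
    exact h q hq p hp ⟨hq', hp', hr.symm⟩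

/-- Trivial paths: a vertex of `P ∩ Q` must lie in the cluster. [this work] -/
theorem reach_of_mem_sepEv_of_mem {P Q : Set V} (h : O ∈ sepEv U E a P Q) {u : V} (huP : u ∈ P) (huQ : u ∈ Q) :
    (sG U O ∅ ∅).Reachable a u := by
  by_contra hu
  exact h u huP u huQ ⟨hu, hu, Reachable.refl _⟩

/-- If some `p ∈ P` and `q ∈ Q` outside the cluster are joined inside its complement, separation fails (definition
unfolding). [this work] -/
theorem not_mem_sepEv {P Q : Set V} {p q : V} (hp : p ∈ P) (hq : q ∈ Q) (hpC : ¬ (sG U O ∅ ∅).Reachable a p)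
    (hqC : ¬ (sG U O ∅ ∅).Reachable a q)
    (hr : (resG U E {z | ¬ (sG U O ∅ ∅).Reachable a z}).Reachable p q) : O ∉ sepEv U E a P Q :=
  fun h => h p hp q hq ⟨hpC, hqC, hr⟩

end Basic

/-! ### The restricted support graph under peeling -/

section Peel

variable {U : Finset V} {E O : Finset (Sym2 V)} {v a : V}

/-- The restricted support graph is monotone in the universe. [this work] -/
theorem resG_mono_univ {U U' : Finset V} (h : U' ⊆ U) (E : Finset (Sym2 V)) (W : Set V) :
    resG U' E W ≤ resG U E W := by
  intro x y hxy
  rw [resG_adj] at hxy ⊢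
  exact ⟨og_mono_univ h E hxy.1, hxy.2⟩

variable [DecidableEq V]

/-- Adding open edges at a vertex `v ∉ U'` does not change the open graph inside `U'`. [this work] -/
theorem og_union_star_eq {U' : Finset V} (hv : v ∉ U') {T : Finset (Sym2 V)} (hT : ∀ e ∈ T, v ∈ e)
    (O : Finset (Sym2 V)) : og U' (T ∪ O) = og U' O := by
  ext x y
  simp only [og_adj, Finset.mem_union]
  constructor
  · rintro ⟨hO | hO, hx, hy, hne⟩
    · have hv' := hT _ hO
      rw [Sym2.mem_iff] at hv'
      rcases hv' with rfl | rfl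
      · exact absurd hx hv
      · exact absurd hy hv
    · exact ⟨hO, hx, hy, hne⟩
  · rintro ⟨hO, hx, hy, hne⟩
    exact ⟨Or.inr hO, hx, hy, hne⟩

/-- … hence neither the structure graph. [this work] -/
theorem sG_union_star_eq {U' : Finset V} (hv : v ∉ U') {T : Finset (Sym2 V)} (hT : ∀ e ∈ T, v ∈ e)
    (O : Finset (Sym2 V)) (A B : Set V) : sG U' (T ∪ O) A B = sG U' O A B := by
  simp only [sG, og_union_star_eq hv hT]

/-- … nor separation. [this work] -/
theorem union_star_mem_sepEv_iff {U' : Finset V} (hv : v ∉ U') {T : Finset (Sym2 V)} (hT : ∀ e ∈ T, v ∈ e)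
    (O : Finset (Sym2 V)) (P Q : Set V) : T ∪ O ∈ sepEv U' E a P Q ↔ O ∈ sepEv U' E a P Q := by
  simp only [mem_sepEv, sG_union_star_eq hv hT]

/-- **First visit of `v`.** A path of the support inside `W` starting at `x ≠ v` either avoids `v` (then it is a path of the
support of `U ∖ v`) or reaches a support-neighbour `d ∈ W` of `v` before its first visit of `v`. [this work] -/
theorem resG_reach_peel {W : Set V} {x y : V} (hx : x ≠ v) (h : (resG U E W).Reachable x y) :
    (y ≠ v ∧ (resG (U.erase v) E W).Reachable x y) ∨
      ∃ d ∈ Kset U E v, d ∈ W ∧ (resG (U.erase v) E W).Reachable x d := by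
  obtain ⟨p⟩ := h
  induction p with
  | nil => exact Or.inl ⟨hx, Reachable.refl _⟩
  | @cons u w z huw p ih =>
    rw [resG_adj] at huw
    by_cases hw : w = v
    · subst hw
      exact Or.inr ⟨u, mem_Kset_of_og_adj huw.1, huw.2.1, Reachable.refl _⟩
    · have hR : (resG (U.erase v) E W).Reachable u w :=
        Adj.reachable (resG_adj.2 ⟨og_erase_adj_of huw.1 hx hw, huw.2⟩)
      rcases ih hw with ⟨hz, hwz⟩ | ⟨d, hd, hdW, hwd⟩
      · exact Or.inl ⟨hz, hR.trans hwz⟩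
      · exact Or.inr ⟨d, hd, hdW, hR.trans hwd⟩

/-- **Peeling rule for separation** (memo Lemma P, sep clause).  Let `v ∈ U`, `v ∉ P`, `v ∈ Q`, `a ≠ v`, and suppose the
plain cluster of `a` computed in `U ∖ v` misses the open neighbours `K` of `v` (so `v ∉ C_a` and the clusters in `U` and
`U ∖ v` agree).  Then `C_a` separates `P` from `Q` in `U` iff, in `U ∖ v`, it separates `P` from `(Q ∖ v) ∪ D_v`, where
`D_v = Kset U E v` is the set of support-neighbours of `v`. [this work] -/
theorem mem_sepEv_peel_iff (hv : v ∈ U) {P Q : Set V} (hvP : v ∉ P) (hvQ : v ∈ Q) (hav : a ≠ v)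
    (hK : ∀ k ∈ Kset U O v, ¬ (sG (U.erase v) O ∅ ∅).Reachable a k) :
    O ∈ sepEv U E a P Q ↔ O ∈ sepEv (U.erase v) E a P ((Q \ {v}) ∪ Kset U E v) := by
  have hve : v ∉ (∅ : Set V) := fun h => h
  -- the clusters agree
  have hC : ∀ y, (sG U O ∅ ∅).Reachable a y ↔ (sG (U.erase v) O ∅ ∅).Reachable a y :=
    reach_iff_peelAvoid hve hve hav hK
  have hvC : ¬ (sG U O ∅ ∅).Reachable a v := (not_reach_v_iff_peelAvoid hv hve hve hav).2 hK
  set W : Set V := {z | ¬ (sG U O ∅ ∅).Reachable a z} with hWdef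
  simp only [mem_sepEv, ← hC]
  constructor
  · intro h p hp q hq ⟨hpC, hqC, hr⟩
    have hr' : (resG U E W).Reachable p q := hr.mono (resG_mono_univ (Finset.erase_subset v U) E W)
    rcases hq with ⟨hqQ, _⟩ | hqD
    · exact h p hp q hqQ ⟨hpC, hqC, hr'⟩
    · -- `q` is a support-neighbour of `v` in `W`: extend the path by the edge `qv`
      have hqv : (resG U E W).Adj q v := resG_adj.2 ⟨og_adj_of_mem_Kset hv hqD, hqC, hvC⟩
      exact h p hp v hvQ ⟨hpC, hvC, hr'.trans hqv.reachable⟩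
  · intro h p hp q hq ⟨hpC, hqC, hr⟩
    have hpv : p ≠ v := fun h' => hvP (h' ▸ hp)
    rcases resG_reach_peel hpv hr with ⟨hqv, hr'⟩ | ⟨d, hd, hdW, hr'⟩
    · exact h p hp q (Or.inl ⟨hq, hqv⟩) ⟨hpC, hqC, hr'⟩
    · exact h p hp d (Or.inr hd) ⟨hpC, hdW, hr'⟩

/-- The peeling rule with `v` on the `P`-side. [this work] -/
theorem mem_sepEv_peel_iff_left (hv : v ∈ U) {P Q : Set V} (hvP : v ∈ P) (hvQ : v ∉ Q) (hav : a ≠ v)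
    (hK : ∀ k ∈ Kset U O v, ¬ (sG (U.erase v) O ∅ ∅).Reachable a k) :
    O ∈ sepEv U E a P Q ↔ O ∈ sepEv (U.erase v) E a ((P \ {v}) ∪ Kset U E v) Q := by
  rw [sepEv_comm P Q, sepEv_comm ((P \ {v}) ∪ Kset U E v) Q]
  exact mem_sepEv_peel_iff hv hvQ hvP hav hK

end Peel

end DualBHK

end Summit.CriticalPhenomena.PercolationContinuityZ3.Theorems
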